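import Literature.MathematicalPhysics.QuantumFieldTheory.Balaban1983to89.B9Eq3105FamThreeLocResolvent
import Literature.MathematicalPhysics.QuantumFieldTheory.Balaban1983to89.B9Eq3105FamThreeLocDiffG
import Literature.MathematicalPhysics.QuantumFieldTheory.Balaban1983to89.B9Cor36SiteSandwichTransfer
import Literature.MathematicalPhysics.QuantumFieldTheory.Balaban1983to89.B9CubeLettersCovarianceL0

/-!
# `Balaban1983to89.B9Eq3105FamThreeLocCDiffSplit` — FAMILY 3 OF (3.105), THE LOCATED `C`-DIFFERENCE WORD `hP3` (D2), FILE F3-B3∕2: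
# (§1) THE NEAR-□ AGREEMENT OF THE TWO PROJECTIONS `P(U₁) = Q′*Q′(U₁)` AND `P_□(V′_□) = Q′*_□Q′_□(V′_□)` SEEN BY ANY CUT-OFF WITHIN `7S_j∕2` — the displayed
# laws `hMP`∕`hPM′` of p38's FILE 1 `B9Eq3105FamThreeLocResolvent` DISCHARGED from the (3.35) datum; (§2–§3) THE EXACT SPLIT OF THE LOCATED DIFFERENCE
# `M_χ·(S − S_□)·M_χ′` INTO FOUR WORDS, EACH CARRYING ONE FAR FACTOR — `1 − M_{χ_□}` (twice) or the commutator step `R_χ = [M_{χ_□}, Δ′_□(V′)]·G′_□(V′)` (twice) —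
# BETWEEN DECAYING LETTERS (sub-row G-B9-LETTERS, GAPS G-B9-05 family 3 (D2); programme FAMTHREE; division lead g35 LAYER WORD FAMTHREE-4a∕4b + RULING 5a:
# FILE 1 p38 g47 (landed p694283), FILE 2 p33 g104)

statement-level skeleton of published theorems with citation tags; proofs where landed; nothing here is a claim about the Yang–Mills mass gap

THE PRINTED LOCUS (verbatim, held `paper:balaban1985-cmp99-background-propagators`, journal page = PDF page + 388).  p. 415 l. 29–31 «Next we replace the
operators G′_{□₀} and C_{□₀} by G′_□, C_□, terms with the differences G′_{□₀} − G′_□ and C_{□₀} − C_□ are small by the same reason as before.»; p. 412 l. 22–36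
«We have proved in [2] that if we have a difference of propagators defined on two domains, then in an estimate of this difference we have, besides the usual
factors …, an exponential factor with a distance between localizations and a closest point where a change was made», «the operators may differ outside □̃₀»;
p. 412 l. 1–9 (the commutator mechanism `G′_□₀χ − χG′_□ = G′_□₀(χΔ′_□ − Δ′_□₀χ)G′_□`); (3.95) p. 411; (3.25) p. 394 (`R = I − G′Q′*(Q′G′²Q′*)⁻¹Q′G′`); (3.48) p. 398;
(3.19)–(3.21) pp. 393–394; p. 410 l. 14–15 «G′_□ depends on U restricted to Ω₀(□) ⊂ □̃⁵»; Cor. 3.6 p. 408 («U′ = U^u = e^{iηA}»); (3.28)–(3.33) pp. 395–396 (gauge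
covariance); p. 414 l. 29–32 (`χ_□ = 1` on the `3S_j`-plateau, supported within `7S_j∕2`).  [2] = `Balaban1983RegularityDecay` (1.11)–(1.12): STATEMENT TYPE ONLY — the
algebra below is OURS, not print's random-walk mechanism.  [4] = `Balaban1984PropagatorsII`: (2.1) p. 224, (2.45) p. 231 (blocks), (2.14)–(2.17) p. 225.

WHAT THIS FILE CERTIFIES (kernel-checked; 0 `def`, 0 `def … : Prop`, 0 sorry; standard axioms only)

* §1 ★★ `cutMulY_mul_proj_eq_gauge` ∕ `proj_mul_cutMulY_eq_gauge` — AT `(U^u, Ṽ_□)`: for a cut-off `χ` supported in `NearC r`, `r ≤ 7S_j∕2`, and the (3.35) datum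
  (`U^u = e^{iηA}` on a window `Q ⊇ NearC (35S_j∕8 + 1)`, `Ṽ_□ = locCfgY i □ η A`): `M_χ·Q′*Q′(U^u) = M_χ·Q′*_□Q′_□(Ṽ_□)` and `Q′*Q′(U^u)·M_χ = Q′*_□Q′_□(Ṽ_□)·M_χ`
  (at `parSymY`); ★★ `cutMulY_mul_proj_eq_at` ∕ `proj_mul_cutMulY_eq_at` — the same AT THE CONSUMER's PAIR `(U, V′)`, `V′ = Ṽ_□^{u⁻¹}`, by (3.31)–(3.33) covariance
  (`proj_eq_conj`, `projCube_gauge_inv_eq`).  Mechanism: a site within `7S_j∕2` lies in r05's `NearH` (p33 `nearH_of_nearC'`), so its member block IS a block of the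
  cube sequence (r05 `coarsen_blkOf_val_of_nearH`), the two averaging rows coincide (p21 `qpK_eq_qpKc`, `blkCornerY_eq_of_val_eq`) and the taxi transporters of
  `U^u` and `Ṽ_□` agree on that block (p21 `agreeNearY_locCfgY_of_nearC'` + `parS_agree_of_agreeNearY`); r05's `QpsY_apply` ∕ `QpsCubeY_apply` read `Q′*`, `Q′*_□`.
  p38's FILE 1 proves the same two laws from an ABSTRACT common-block window (`cutMulY_P_eq_cutMulY_Pb`, `P_mul_cutMulY_eq_Pb_mul_cutMulY`); §1 is the DATUM form
  (no window to exhibit), valid for `χ_□ = chiY` (`nearC_of_chiY_ne_zero`), F3-P's `χl_□` and any sharp indicator `𝟙[NearC r]`, `r ≤ 7S_j∕2`, alike.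
* §2 (any ring) ★ `core_split` — under `SP = S`, `P_□S_□ = S_□`, `MP = MP_□`, `PM = P_□M`:
  `S·(P_□K_□P_□ − PKP)·S_□ = S·P_□·(1 − M)·K_□·S_□ − S·K·(1 − M)·P·S_□ + S·(M·K_□ − K·M)·S_□`; ★ `cut_sq_sub_sq_cut_eq_neg_commStep` — under `AΔ₁ = 1`, `Δ₂B = 1`,
  `Δ₁M = Δ₂M`: `M·(BB) − (AA)·M = −(AA·R + A·R·B)`, `R = (MΔ₂ − Δ₂M)·B` (a corollary of p21's `B9ThmDLocDiffAlgebra.mul_self_sub_mul_self_eq_comm_form`, BY NAME);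
  ★ `cut_core_fourWords` — both combined between outer cut-offs `M, M′` (the shape §3 instantiates).
* §3 ★★★ `cut_locCDiff_cut_eq_fourWords` — AT THE CONSUMER's PAIR `(U, V′)`, EVERY LAW DISCHARGED BUT THE UNITS: for outer cut-offs `χ, χ′` supported within `7S_j∕2`,
  the (3.35) datum, `IsUnit X(U)`, `IsUnit X_□(V′)` ((3.25): Thm 3.2's regime) and `IsUnit Δ′(U)`, `IsUnit Δ′_□(V′)` ((3.11), displayed as everywhere in the tree):
  `M_χ(S − S_□)M_χ′ = M_χ·S·P_□·(1 − M_{χ_□})·G′_□(V′)²·S_□·M_χ′ − M_χ·S·G′(U)²·(1 − M_{χ_□})·P·S_□·M_χ′ − M_χ·S·G′(U)²·R_χ·S_□·M_χ′ − M_χ·S·G′(U)·R_χ·G′_□(V′)·S_□·M_χ′`,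
  `S = Q′*X⁻¹Q′(U)`, `S_□ = Q′*_□X_□⁻¹Q′_□(V′)`, `P = Q′*Q′(U)`, `P_□ = Q′*_□Q′_□(V′)`, `R_χ = (M_{χ_□}Δ′_□(V′) − Δ′_□(V′)M_{χ_□})·G′_□(V′)` — EXACTLY F3-E2b's commutator-step
  letter at `V′` (`B9Eq3105FamThreeCommStepMember.hasMajorant_conj_commStep_member`, datum package F3-E2e `B9Eq3105FamThreeCommStepAtDatum.commStep_at_datum`).
  Ingredients BY NAME: p38's (II) `cut_sub_cut_eq_resolvent_form` with its letter laws `S_mul_A_eq_P`, `S_mul_P_eq_S`, `Ab_mul_Sb_eq_Pb`, `Pb_mul_Sb_eq_Sb` (`Q′Q′* = 1`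
  PROVED there: `QpY_comp_QpsY`, `QpCubeY_comp_QpsCubeY`); §1's agreements for `χ`, `χ′` and `χ_□`; def-Y `GpY_mul_deltaPrimeAY`, r05 `deltaPrimeACubeY_mul_GpCubeY`;
  F3-E1 `B9Eq3105FamThreeLocDiffG.deltaPrimeAY_mul_cutMulY_chiY_at` (`Δ′(U)M_{χ_□} = Δ′_□(V′)M_{χ_□}` from the datum).

ROAD (ours).  F3-P's `hP3 □` reads `conj b((D_U·M_{χl}·B·(S − S_□)·B·M_{χl}·D*_U)^ℝ)`, `B = G′_□(V′)`.  p38's `sandwich_split` inserts a sharp near cut-off `M₂ = M_{𝟙[NearC r₂]}`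
(`21S_j∕8 < r₂ < 3S_j`, e.g. `r₂ = 11S_j∕4`) on both inner sides (core + two leaks, the leaks separated from `supp χl ⊆ NearC(21S_j∕8)` by `r₂ − 21S_j∕8`); §3 writes the
core `M₂(S − S_□)M₂` as FOUR words, each a chain of decaying letters from the near rows of `M₂` to ONE far factor: `1 − M_{χ_□}` vanishes on the `3S_j`-plateau
(separation `3S_j − r₂` from `M₂`), and `R_χ`'s rows lie in the transition annulus of `χ_□` (`¬NearC(3S_j − b_j)`, F3-E2e; separation `3S_j − b_j − r₂`).  WHY NOT THE
THEOREM-D OBJECT `A² − O_□²` (p21 `B9ThmDLocDiffMajorants`): its kernels D4∕D5 are wired to cut-offs within `2S_j` of □, while F3-P's `χl_□` reaches `21S_j∕8 > 2S_j` —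
the soft localisation through `S`, `S_□` above needs no plateau INSIDE the sandwich and prices every word by one separation ([4] (2.83)).  The kernel files
(F3-B3∕3+) price: `conj(s·S)` ((3.48) + the `Q′` homs), the cube words at `V′` (r05 `B9Cor36GpCubeExtAtV`, `B9Cor36CinvCubeAtLocCfg`; cube carrier → member by
p21∕p38's sandwich transfers), `R_χ` (F3-E2b∕E2e), the far factors by p38's collar lemmas (`B9Cor36CollarSeparation`), and the outer entries `η⁻¹∇·η²M_{χl}B`,
`η²BM_{χl}·η⁻¹∇*` ((3.100), cube entries at `Ṽ_□`).

HONEST SCOPE ∕ NOT CLAIMED.  Exact finite lattice algebra at def-Y's ∕ r05's DEFINED letters; no inequality of the paper.  Count-neutral; NOT a node discharge;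
no summit ∕ sub-problem statement is proved; nothing continuum ∕ OS ∕ mass-gap ∕ Clay; YM mass gap NOT proved (Track A conditional rung).  No `sorry`, no
`axiom`, no `… : Prop` fact, no `instance`, no `notation`, no `def`.  NEW file; nothing landed is modified.  Cell `lit-balaban`, seat `lit-balaban-p33` gen 104,
2026-08-29; `--supports stmt-QuantumFields-19200` as helper.  Net new unproved facts: 0.

RELATED IN THE TREE, NOT DUPLICATED (searched 2026-08-29: `rg 'proj_mul_cutMulY|cutMulY_mul_proj|core_split|fourWords' Literature/` = ∅): p38 F3-B3 FILE 1 `B9Eq3105FamThreeLocResolvent`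
(the located resolvent identity with these laws DISPLAYED, and the laws from an abstract window), r05 `B9Thm39CinvSandwichQ.QpsY_apply` ∕ `B9Cor36CubeSandwichQ.QpsCubeY_apply`, p21
`B9Cor36CinvCubeLocLetter` (bridge lemmas), `B9ThmDCubePlateau` (the datum's `AgreeNearY` out to `4S_j`), p38 `B9Cor36SiteSandwichTransfer.blkCubeY_eq_of_blkOf_eq_of_nearH`, r05
`B9CubeCoarsening`, `B9CubeLettersCovarianceL0` (`QpCubeY_cov`, `QpsCubeY_cov`), def-Y `Node00.OpsYGauge` (`QpY_cov`, `QpsY_cov`), p21 `B9ThmDLocDiffAlgebra` (the one-lattice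
commutator form; §2 is its corollary), F3-E1 `B9Eq3105FamThreeLocDiffG` (the `Δ′`-agreement at the pair) — all USED BY NAME.

v1.1 (p33 gen 106, 2026-08-29; DOC-ONLY, declarations byte-identical): page numerals corrected — (3.25) «Rf = (I − G′Q′*(Q′G′²Q′*)⁻¹Q′G′)f» is printed on
p. 394 (not p. 395; ×4 in the cite tags of `cutMulY_mul_proj_eq_gauge` ∕ `proj_mul_cutMulY_eq_gauge` ∕ `cutMulY_mul_proj_eq_at` ∕ `proj_mul_cutMulY_eq_at`, and «pp. 394–395» ×2
in the printed locus ∕ `cut_locCDiff_cut_eq_fourWords`)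
and (3.11) (the display introducing `J = D*η⁻² Im ∂U`) on p. 392 (not p. 391; ×1) — text layer of the held `paper:balaban1985-cmp99-background-propagators` PDF pp. 6, 4
re-read; [B9] page desk r06 g70 landing sweep №68 of 2026-08-29T04:54:44Z.
-/

noncomputable section

namespace Literature.MathematicalPhysics.QuantumFieldTheory.Balaban1983to89.B9Eq3105FamThreeLocCDiffSplit

open B6KLevelCensusIndexV1 (KIdx)
open B6Cover236MultiLevelBlocks (cubes)
open B6Geom246MultiLevelBox (bset blkOf)
open B6GlobalChartV1 (PV boxEquiv)
open B9Eq39Adjoint (R fluct)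
open B9Eq360DeltaPrimeAY (AfldY)
open B9Eq360DeltaPrimeACubeY (blkCubeY)
open B9CubeLettersOpsL0 (cubeFamY oddMh two_le_R GpCubeY deltaPrimeACubeY deltaPrimeACubeY_mul_GpCubeY)
open B9CubeLettersBondOpsL0 (BlkCubeY qpKc qpTc blkCornerCubeY QpCubeY QpsCubeY XCubeY XinvCubeY)
open B9CubeCoarsening (coarsen_blkOf_val_of_nearH)
open B9Cor36CubeTwinsGeometry (bS one_le_bS eight_mul_bS_le_SC)
open B9Cor36CubeCutoffs (SC NearC chiY one_le_SC nine_le_SC locCfgY nearC_of_chiY_ne_zero)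
open B9Cor36CutoffSecondDiff (nearH_of_nearC')
open B9Cor36CinvCubeLocLetter (blkOf_eq_iff_of_val_eq qpK_eq_qpKc blkCornerY_eq_of_val_eq parS_agree_of_agreeNearY)
open B9Cor36SiteSandwichTransfer (blkCubeY_eq_of_blkOf_eq_of_nearH)
open B9Cor36GpCubeLocLetter (conjY_inv_mul_conjY conjY_mul_conjY_inv cutMulY_mul_conjY)
open B9ThmDCubePlateau (agreeNearY_locCfgY_of_nearC')
open B9Thm37CubeCoverCommutators (cutMulY cutMulY_apply)
open B9Thm39CinvSandwichQ (QpsY_apply)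
open B9Cor36CubeSandwichQ (QpsCubeY_apply)
open B9Eq357CubeLetters (qpKc_of_blkOf_ne blkOf_of_qpKc_ne_zero)
open Node00 (SiteY BlkY CfgY GaugeY SiteParY SiteOpY toKT parSymY gaugeY gSiteY gBlkY conjY UboxY QpY QpsY qpK qpT blkCornerY trLiftY trLiftY_apply
  XY XinvY IsGaugeLawS parSymY_isGaugeLawS QpY_cov QpsY_cov Intw GpY deltaPrimeAY GpY_mul_deltaPrimeAY)
open Node00.OpsYLocalInverseAgree (AgreeNearY parLocalY_parSymY)
open B9CubeLettersCovarianceL0 (QpCubeY_cov QpsCubeY_cov gBlkCubeY)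
open B9Eq3105FamThreeLocResolvent (cut_sub_cut_eq_resolvent_form S_mul_A_eq_P S_mul_P_eq_S Ab_mul_Sb_eq_Pb Pb_mul_Sb_eq_Sb QpY_comp_QpsY QpCubeY_comp_QpsCubeY)
open B9ThmDLocDiffAlgebra (mul_self_sub_mul_self_eq_comm_form)
open B9Eq3105FamThreeLocDiffG (deltaPrimeAY_mul_cutMulY_chiY_at)

variable {d ℓ : ℕ} {hd : 1 ≤ d + 1} {hL : Odd (ℓ + 1) ∧ 1 < ℓ + 1} {b₀ b₁ : ℝ}
variable {𝔸 : Type} [NormedRing 𝔸] [NormedAlgebra ℂ 𝔸] [CompleteSpace 𝔸]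

/-! ## §1  The two projections agree near □ (the laws `hMP`, `hPM′` of FILE 1 discharged from the (3.35) datum) -/

section Agreement

variable (i : KIdx d ℓ hd hL b₀ b₁) (c : ↥(cubes (toKT i).D.toDomains))

/-- a site within `7S_j∕2` of the centre lies in r05's `NearH` (`7S_j∕2 ≤ 4S_j`). [cite: Balaban1985BackgroundPropagators, p.408 (□̃³ ⊂ Ω_j(□) = □̃⁴), bookkeeping] -/
theorem nearH_of_nearC_seven_halves {r : ℤ} (hr : r ≤ 7 * SC i c / 2) {z : SiteY i} (hz : NearC i c r z.1) : B9CubeSequence408.NearH c z.1 := by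
  have hS := one_le_SC i c
  exact nearH_of_nearC' i c (by omega) hz

/-- near □ the member block of a site and its block in the cube sequence carry the same `(level, label)` pair. [cite: Balaban1984PropagatorsII, (2.45) p.231; Balaban1985BackgroundPropagators, p.408] -/
theorem blkOf_val_eq_blkCubeY_val {z : SiteY i} (hz : B9CubeSequence408.NearH c z.1) : (blkOf i.D.toDomains z).1 = (blkCubeY i c z).1 :=
  coarsen_blkOf_val_of_nearH (hL := hL.1) (hM := oddMh i) (hMh := (toKT i).hMh) (hP := (toKT i).hP) (two_le_R i) hz

/-- the (3.35) datum makes `U^u` and `Ṽ_□` agree, in def-Y's sense, at every site within `7S_j∕2` (`4·(7S_j∕2 + L^{j+1}) ≤ 15S_j` as `8L^{j+1} ≤ S_j`).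
[cite: Balaban1985BackgroundPropagators, Cor. 3.6 p.408, p.410 l.14–15] -/
theorem agreeNearY_singleton_of_datum (g : GaugeY 𝔸 i) (U : CfgY 𝔸 i) {Q : Set (Site (PV d ℓ i.m i.K hd hL) 0)} (η : ℝ) (A : AfldY 𝔸 i)
    (hQ : ∀ x : Site (PV d ℓ i.m i.K hd hL) 0, NearC i c (35 * SC i c / 8 + 1) (boxEquiv i.hN x).1 → x ∈ Q)
    (hgA : ∀ (κ : Fin (d + 1)) (x : Site (PV d ℓ i.m i.K hd hL) 0), x ∈ Q → x.shift κ ∈ Q → gaugeY i g U κ x = fluct η A κ x)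
    {r : ℤ} (hr : r ≤ 7 * SC i c / 2) {z : SiteY i} (hz : NearC i c r z.1) :
    AgreeNearY i {z} (gaugeY i g U) (locCfgY i c η A) := by
  have hS := one_le_SC i c
  have h8 := eight_mul_bS_le_SC i c
  exact agreeNearY_locCfgY_of_nearC' i c η A hQ hgA (R := r) (by omega) (by omega) fun w hw => by
    rw [Finset.mem_singleton] at hw; rw [hw]; exact hz

/-- ★ **THE AVERAGING TRANSPORTERS OF `U^u` AND `Ṽ_□` AGREE ON THE WHOLE BLOCK OF A SITE WITHIN `7S_j∕2`** (corner-to-site taxi runs inside the block).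
[cite: Balaban1985BackgroundPropagators, (3.19)–(3.21) pp.393–394 («U(Γ_{y,x})»), p.410 l.14–15, Cor. 3.6 p.408] -/
theorem qpTc_agree_of_datum (g : GaugeY 𝔸 i) (U : CfgY 𝔸 i) {Q : Set (Site (PV d ℓ i.m i.K hd hL) 0)} (η : ℝ) (A : AfldY 𝔸 i)
    (hQ : ∀ x : Site (PV d ℓ i.m i.K hd hL) 0, NearC i c (35 * SC i c / 8 + 1) (boxEquiv i.hN x).1 → x ∈ Q)
    (hgA : ∀ (κ : Fin (d + 1)) (x : Site (PV d ℓ i.m i.K hd hL) 0), x ∈ Q → x.shift κ ∈ Q → gaugeY i g U κ x = fluct η A κ x)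
    {r : ℤ} (hr : r ≤ 7 * SC i c / 2) {z₀ : SiteY i} (hz₀ : NearC i c r z₀.1) (w : SiteY i) (hw : blkCubeY i c w = blkCubeY i c z₀) :
    qpTc i c (parSymY i) (gaugeY i g U) (blkCubeY i c z₀) w = qpTc i c (parSymY i) (locCfgY i c η A) (blkCubeY i c z₀) w := by
  have hH := nearH_of_nearC_seven_halves i c hr hz₀
  have hts := blkOf_val_eq_blkCubeY_val i c hH
  have hmem : (blkCubeY i c z₀).1 ∈ bset i.D.toDomains := by rw [← hts]; exact (blkOf i.D.toDomains z₀).2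
  exact parS_agree_of_agreeNearY i c (parLocalY_parSymY i) (agreeNearY_singleton_of_datum i c g U η A hQ hgA hr hz₀) {blkCubeY i c z₀}
    (fun s hs => by rw [Finset.mem_singleton] at hs; rw [hs]; exact hmem)
    (fun s hs => ⟨z₀, Finset.mem_singleton_self _, by rw [Finset.mem_singleton] at hs; rw [hs]; rfl⟩) _ (Finset.mem_singleton_self _) w hw

/-- ★ **ON THE BLOCK OF A SITE WITHIN `7S_j∕2`, `Q′(U^u)` AND `Q′_□(Ṽ_□)` HAVE THE SAME ROW** (same kernel row, same corner, agreeing transporters).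
[cite: Balaban1985BackgroundPropagators, (3.19)–(3.21) pp.393–394, p.409 l.2–5, p.410 l.14–15] -/
theorem QpY_gauge_apply_eq_QpCubeY_apply (g : GaugeY 𝔸 i) (U : CfgY 𝔸 i) {Q : Set (Site (PV d ℓ i.m i.K hd hL) 0)} (η : ℝ) (A : AfldY 𝔸 i)
    (hQ : ∀ x : Site (PV d ℓ i.m i.K hd hL) 0, NearC i c (35 * SC i c / 8 + 1) (boxEquiv i.hN x).1 → x ∈ Q)
    (hgA : ∀ (κ : Fin (d + 1)) (x : Site (PV d ℓ i.m i.K hd hL) 0), x ∈ Q → x.shift κ ∈ Q → gaugeY i g U κ x = fluct η A κ x)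
    {r : ℤ} (hr : r ≤ 7 * SC i c / 2) {z₀ : SiteY i} (hz₀ : NearC i c r z₀.1) (Λ : SiteY i → 𝔸) :
    QpY i (parSymY i) (gaugeY i g U) Λ (blkOf i.D.toDomains z₀) = QpCubeY i c (parSymY i) (locCfgY i c η A) Λ (blkCubeY i c z₀) := by
  have hts := blkOf_val_eq_blkCubeY_val i c (nearH_of_nearC_seven_halves i c hr hz₀)
  rw [show QpY i (parSymY i) (gaugeY i g U) = trLiftY (qpK i) (qpT i (parSymY i) (gaugeY i g U)) from rfl,
    show QpCubeY i c (parSymY i) (locCfgY i c η A) = trLiftY (qpKc i c) (qpTc i c (parSymY i) (locCfgY i c η A)) from rfl,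
    trLiftY_apply, trLiftY_apply]
  refine Finset.sum_congr rfl fun w _ => ?_
  rw [qpK_eq_qpKc i c hts]
  by_cases hw : blkCubeY i c w = blkCubeY i c z₀
  · rw [show qpT i (parSymY i) (gaugeY i g U) (blkOf i.D.toDomains z₀) w = qpTc i c (parSymY i) (gaugeY i g U) (blkCubeY i c z₀) w from by
        show parSymY i (gaugeY i g U) (blkCornerY i (blkOf i.D.toDomains z₀)) w = parSymY i (gaugeY i g U) (blkCornerCubeY i c (blkCubeY i c z₀)) w
        rw [blkCornerY_eq_of_val_eq i c hts],
      qpTc_agree_of_datum i c g U η A hQ hgA hr hz₀ w hw]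
  · rw [qpKc_of_blkOf_ne i c hw, Complex.ofReal_zero, zero_smul, zero_smul]

/-- ★★ **`M_χ·Q′*Q′(U^u) = M_χ·Q′*_□Q′_□(Ṽ_□)` FOR A CUT-OFF WITHIN `7S_j∕2`** (FILE 1's law `hMP` at the gauged pair): at a row `z` with `χ(z) ≠ 0` both sides
read the common block of `z` with the common (inverse) corner transporter. [cite: Balaban1985BackgroundPropagators, (3.19)–(3.21) pp.393–394, (3.25) p.394, p.410 l.14–15, p.412 l.22–36, Cor. 3.6 p.408] -/
theorem cutMulY_mul_proj_eq_gauge (g : GaugeY 𝔸 i) (U : CfgY 𝔸 i) {Q : Set (Site (PV d ℓ i.m i.K hd hL) 0)} (η : ℝ) (A : AfldY 𝔸 i)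
    (hQ : ∀ x : Site (PV d ℓ i.m i.K hd hL) 0, NearC i c (35 * SC i c / 8 + 1) (boxEquiv i.hN x).1 → x ∈ Q)
    (hgA : ∀ (κ : Fin (d + 1)) (x : Site (PV d ℓ i.m i.K hd hL) 0), x ∈ Q → x.shift κ ∈ Q → gaugeY i g U κ x = fluct η A κ x)
    (χ : SiteY i → ℝ) {r : ℤ} (hr : r ≤ 7 * SC i c / 2) (hχ : ∀ z, χ z ≠ 0 → NearC i c r z.1) :
    cutMulY (𝔸 := 𝔸) χ * (QpsY i (parSymY i) (gaugeY i g U) ∘ₗ QpY i (parSymY i) (gaugeY i g U)) =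
      cutMulY (𝔸 := 𝔸) χ * (QpsCubeY i c (parSymY i) (locCfgY i c η A) ∘ₗ QpCubeY i c (parSymY i) (locCfgY i c η A)) := by
  refine LinearMap.ext fun Λ => funext fun z => ?_
  rw [Module.End.mul_apply, Module.End.mul_apply, cutMulY_apply, cutMulY_apply, LinearMap.comp_apply, LinearMap.comp_apply]
  by_cases hz : χ z = 0
  · rw [hz, Complex.ofReal_zero, zero_smul, zero_smul]
  have hzN := hχ z hz
  congr 1
  rw [QpsY_apply i (parSymY i), QpsCubeY_apply i c (parSymY i), show B6Geom246MultiLevelBoxL0.blkOf (cubeFamY i c).toDomains z = blkCubeY i c z from rfl,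
    QpY_gauge_apply_eq_QpCubeY_apply i c g U η A hQ hgA hr hzN,
    show qpT i (parSymY i) (gaugeY i g U) (blkOf i.D.toDomains z) z = qpTc i c (parSymY i) (gaugeY i g U) (blkCubeY i c z) z from by
      show parSymY i (gaugeY i g U) (blkCornerY i (blkOf i.D.toDomains z)) z = parSymY i (gaugeY i g U) (blkCornerCubeY i c (blkCubeY i c z)) z
      rw [blkCornerY_eq_of_val_eq i c (blkOf_val_eq_blkCubeY_val i c (nearH_of_nearC_seven_halves i c hr hzN))],
    qpTc_agree_of_datum i c g U η A hQ hgA hr hzN z rfl]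

/-- ★★ **`Q′*Q′(U^u)·M_χ = Q′*_□Q′_□(Ṽ_□)·M_χ` FOR A CUT-OFF WITHIN `7S_j∕2`** (FILE 1's law `hPM′` at the gauged pair): a row `z` of either side reads `χΛ` on
the block of `z` only; if that block meets `supp χ` it is a common block with agreeing transporters (p38 `blkCubeY_eq_of_blkOf_eq_of_nearH`), else both sides vanish.
[cite: Balaban1985BackgroundPropagators, (3.19)–(3.21) pp.393–394, (3.25) p.394, p.410 l.14–15, p.412 l.22–36, Cor. 3.6 p.408] -/
theorem proj_mul_cutMulY_eq_gauge (g : GaugeY 𝔸 i) (U : CfgY 𝔸 i) {Q : Set (Site (PV d ℓ i.m i.K hd hL) 0)} (η : ℝ) (A : AfldY 𝔸 i)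
    (hQ : ∀ x : Site (PV d ℓ i.m i.K hd hL) 0, NearC i c (35 * SC i c / 8 + 1) (boxEquiv i.hN x).1 → x ∈ Q)
    (hgA : ∀ (κ : Fin (d + 1)) (x : Site (PV d ℓ i.m i.K hd hL) 0), x ∈ Q → x.shift κ ∈ Q → gaugeY i g U κ x = fluct η A κ x)
    (χ : SiteY i → ℝ) {r : ℤ} (hr : r ≤ 7 * SC i c / 2) (hχ : ∀ z, χ z ≠ 0 → NearC i c r z.1) :
    (QpsY i (parSymY i) (gaugeY i g U) ∘ₗ QpY i (parSymY i) (gaugeY i g U)) * cutMulY (𝔸 := 𝔸) χ =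
      (QpsCubeY i c (parSymY i) (locCfgY i c η A) ∘ₗ QpCubeY i c (parSymY i) (locCfgY i c η A)) * cutMulY (𝔸 := 𝔸) χ := by
  refine LinearMap.ext fun Λ => funext fun z => ?_
  rw [Module.End.mul_apply, Module.End.mul_apply, LinearMap.comp_apply, LinearMap.comp_apply, QpsY_apply i (parSymY i), QpsCubeY_apply i c (parSymY i),
    show B6Geom246MultiLevelBoxL0.blkOf (cubeFamY i c).toDomains z = blkCubeY i c z from rfl]
  by_cases hex : ∃ w : SiteY i, blkOf i.D.toDomains w = blkOf i.D.toDomains z ∧ χ w ≠ 0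
  · -- the block of `z` meets `supp χ` at `w₀`: it is a common block, read identically
    obtain ⟨w₀, hw₀, hχ₀⟩ := hex
    have hN₀ := hχ w₀ hχ₀
    have hH₀ := nearH_of_nearC_seven_halves i c hr hN₀
    have hcz : blkCubeY i c z = blkCubeY i c w₀ := blkCubeY_eq_of_blkOf_eq_of_nearH i c hH₀ hw₀.symm
    rw [← hw₀, hcz, QpY_gauge_apply_eq_QpCubeY_apply i c g U η A hQ hgA hr hN₀,
      show qpT i (parSymY i) (gaugeY i g U) (blkOf i.D.toDomains w₀) z = qpTc i c (parSymY i) (gaugeY i g U) (blkCubeY i c w₀) z from by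
        show parSymY i (gaugeY i g U) (blkCornerY i (blkOf i.D.toDomains w₀)) z = parSymY i (gaugeY i g U) (blkCornerCubeY i c (blkCubeY i c w₀)) z
        rw [blkCornerY_eq_of_val_eq i c (blkOf_val_eq_blkCubeY_val i c hH₀)],
      qpTc_agree_of_datum i c g U η A hQ hgA hr hN₀ z hcz]
  · -- the block of `z` misses `supp χ`: both averages of `χΛ` over it vanish
    push Not at hex
    have hL0 : QpY i (parSymY i) (gaugeY i g U) (cutMulY (𝔸 := 𝔸) χ Λ) (blkOf i.D.toDomains z) = 0 := by
      rw [show QpY i (parSymY i) (gaugeY i g U) = trLiftY (qpK i) (qpT i (parSymY i) (gaugeY i g U)) from rfl, trLiftY_apply]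
      refine Finset.sum_eq_zero fun w _ => ?_
      by_cases hw : blkOf i.D.toDomains w = blkOf i.D.toDomains z
      · rw [cutMulY_apply, hex w hw, Complex.ofReal_zero, zero_smul, B9Eq39Adjoint.R_zero, smul_zero]
      · rw [show qpK i (blkOf i.D.toDomains z) w = 0 from if_neg hw, Complex.ofReal_zero, zero_smul]
    have hR0 : QpCubeY i c (parSymY i) (locCfgY i c η A) (cutMulY (𝔸 := 𝔸) χ Λ) (blkCubeY i c z) = 0 := by
      rw [show QpCubeY i c (parSymY i) (locCfgY i c η A) = trLiftY (qpKc i c) (qpTc i c (parSymY i) (locCfgY i c η A)) from rfl, trLiftY_apply]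
      refine Finset.sum_eq_zero fun w _ => ?_
      by_cases hχw : χ w = 0
      · rw [cutMulY_apply, hχw, Complex.ofReal_zero, zero_smul, B9Eq39Adjoint.R_zero, smul_zero]
      · -- `χ w ≠ 0`: `w` is near, so if `w` lay in the cube block of `z` it would lie in the member block of `z`
        by_cases hcw : blkCubeY i c w = blkCubeY i c z
        · exfalso
          have hHw := nearH_of_nearC_seven_halves i c hr (hχ w hχw)
          have hts : (blkOf i.D.toDomains w).1 = (blkCubeY i c z).1 := by rw [← hcw]; exact blkOf_val_eq_blkCubeY_val i c hHw
          have hzw : blkOf i.D.toDomains z = blkOf i.D.toDomains w := (blkOf_eq_iff_of_val_eq i c hts z).2 rfl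
          exact hχw (hex w hzw.symm)
        · rw [show qpKc i c (blkCubeY i c z) w = 0 from qpKc_of_blkOf_ne i c hcw, Complex.ofReal_zero, zero_smul]
    rw [hL0, hR0, B9Eq39Adjoint.R_zero, B9Eq39Adjoint.R_zero]

/-! ### §1b  The same at the consumer's pair `(U, Ṽ_□^{u⁻¹})` ((3.31)–(3.33): both projections are `R(u)`-conjugates; `M_χ` commutes with `R(u)`) -/

/-- (3.32) for the member's projection: `Q′*Q′(U) = R(u)⁻¹·Q′*Q′(U^u)·R(u)`. [cite: Balaban1985BackgroundPropagators, (3.31)–(3.32) p.395, (3.21) p.394] -/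
theorem proj_eq_conj (g : GaugeY 𝔸 i) (U : CfgY 𝔸 i) :
    (QpsY i (parSymY i) U ∘ₗ QpY i (parSymY i) U : Module.End ℂ (SiteY i → 𝔸)) =
      conjY (gSiteY i g)⁻¹ * (QpsY i (parSymY i) (gaugeY i g U) ∘ₗ QpY i (parSymY i) (gaugeY i g U)) * conjY (gSiteY i g) := by
  have hcov : (QpsY i (parSymY i) (gaugeY i g U) ∘ₗ QpY i (parSymY i) (gaugeY i g U)) * conjY (gSiteY i g) =
      conjY (gSiteY i g) * (QpsY i (parSymY i) U ∘ₗ QpY i (parSymY i) U) :=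
    (QpsY_cov g U (parSymY_isGaugeLawS i)).comp (QpY_cov g U (parSymY_isGaugeLawS i))
  rw [mul_assoc, hcov, ← mul_assoc, conjY_inv_mul_conjY, one_mul]

/-- (3.32) for the cube sequence's projection at the gauged-back field: `Q′*_□Q′_□(Ṽ^{u⁻¹}) = R(u)⁻¹·Q′*_□Q′_□(Ṽ)·R(u)`.
[cite: Balaban1985BackgroundPropagators, (3.31)–(3.32) p.395, p.409 l.3–5] -/
theorem projCube_gauge_inv_eq (g : GaugeY 𝔸 i) (V : CfgY 𝔸 i) :
    (QpsCubeY i c (parSymY i) (gaugeY i g⁻¹ V) ∘ₗ QpCubeY i c (parSymY i) (gaugeY i g⁻¹ V) : Module.End ℂ (SiteY i → 𝔸)) =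
      conjY (gSiteY i g)⁻¹ * (QpsCubeY i c (parSymY i) V ∘ₗ QpCubeY i c (parSymY i) V) * conjY (gSiteY i g) := by
  have h : (QpsCubeY i c (parSymY i) (gaugeY i g⁻¹ V) ∘ₗ QpCubeY i c (parSymY i) (gaugeY i g⁻¹ V)) * conjY (gSiteY i g)⁻¹ =
      conjY (gSiteY i g)⁻¹ * (QpsCubeY i c (parSymY i) V ∘ₗ QpCubeY i c (parSymY i) V) :=
    (QpsCubeY_cov c g⁻¹ V (parSymY_isGaugeLawS i)).comp (QpCubeY_cov c g⁻¹ V (parSymY_isGaugeLawS i))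
  rw [← h, mul_assoc, conjY_inv_mul_conjY, mul_one]

/-- ★★ **THE ROW LAW `hMP` AT THE CONSUMER's PAIR**: `M_χ·Q′*Q′(U) = M_χ·Q′*_□Q′_□(Ṽ_□^{u⁻¹})` for a cut-off supported within `7S_j∕2`.
[cite: Balaban1985BackgroundPropagators, (3.19)–(3.21) pp.393–394, (3.25) p.394, (3.31)–(3.33) pp.395–396, p.410 l.14–15, p.412 l.22–36, Cor. 3.6 p.408] -/
theorem cutMulY_mul_proj_eq_at (g : GaugeY 𝔸 i) (U : CfgY 𝔸 i) {Q : Set (Site (PV d ℓ i.m i.K hd hL) 0)} (η : ℝ) (A : AfldY 𝔸 i)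
    (hQ : ∀ x : Site (PV d ℓ i.m i.K hd hL) 0, NearC i c (35 * SC i c / 8 + 1) (boxEquiv i.hN x).1 → x ∈ Q)
    (hgA : ∀ (κ : Fin (d + 1)) (x : Site (PV d ℓ i.m i.K hd hL) 0), x ∈ Q → x.shift κ ∈ Q → gaugeY i g U κ x = fluct η A κ x)
    (χ : SiteY i → ℝ) {r : ℤ} (hr : r ≤ 7 * SC i c / 2) (hχ : ∀ z, χ z ≠ 0 → NearC i c r z.1) :
    cutMulY (𝔸 := 𝔸) χ * (QpsY i (parSymY i) U ∘ₗ QpY i (parSymY i) U) =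
      cutMulY (𝔸 := 𝔸) χ * (QpsCubeY i c (parSymY i) (gaugeY i g⁻¹ (locCfgY i c η A)) ∘ₗ QpCubeY i c (parSymY i) (gaugeY i g⁻¹ (locCfgY i c η A))) := by
  rw [proj_eq_conj i g U, projCube_gauge_inv_eq i c g]
  set Γ : Module.End ℂ (SiteY i → 𝔸) := conjY (gSiteY i g)
  set Γi : Module.End ℂ (SiteY i → 𝔸) := conjY (gSiteY i g)⁻¹
  set C : Module.End ℂ (SiteY i → 𝔸) := cutMulY (𝔸 := 𝔸) χ
  have e : C * Γi = Γi * C := cutMulY_mul_conjY i _ _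
  have law := cutMulY_mul_proj_eq_gauge i c g U η A hQ hgA χ hr hχ
  calc C * (Γi * (QpsY i (parSymY i) (gaugeY i g U) ∘ₗ QpY i (parSymY i) (gaugeY i g U)) * Γ)
        = Γi * (C * (QpsY i (parSymY i) (gaugeY i g U) ∘ₗ QpY i (parSymY i) (gaugeY i g U))) * Γ := by rw [← mul_assoc, ← mul_assoc, e]; noncomm_ring
    _ = Γi * (C * (QpsCubeY i c (parSymY i) (locCfgY i c η A) ∘ₗ QpCubeY i c (parSymY i) (locCfgY i c η A))) * Γ := by rw [law]
    _ = _ := by rw [← mul_assoc Γi C, ← e]; noncomm_ring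

/-- ★★ **THE COLUMN LAW `hPM′` AT THE CONSUMER's PAIR**: `Q′*Q′(U)·M_χ = Q′*_□Q′_□(Ṽ_□^{u⁻¹})·M_χ` for a cut-off supported within `7S_j∕2`.
[cite: Balaban1985BackgroundPropagators, (3.19)–(3.21) pp.393–394, (3.25) p.394, (3.31)–(3.33) pp.395–396, p.410 l.14–15, p.412 l.22–36, Cor. 3.6 p.408] -/
theorem proj_mul_cutMulY_eq_at (g : GaugeY 𝔸 i) (U : CfgY 𝔸 i) {Q : Set (Site (PV d ℓ i.m i.K hd hL) 0)} (η : ℝ) (A : AfldY 𝔸 i)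
    (hQ : ∀ x : Site (PV d ℓ i.m i.K hd hL) 0, NearC i c (35 * SC i c / 8 + 1) (boxEquiv i.hN x).1 → x ∈ Q)
    (hgA : ∀ (κ : Fin (d + 1)) (x : Site (PV d ℓ i.m i.K hd hL) 0), x ∈ Q → x.shift κ ∈ Q → gaugeY i g U κ x = fluct η A κ x)
    (χ : SiteY i → ℝ) {r : ℤ} (hr : r ≤ 7 * SC i c / 2) (hχ : ∀ z, χ z ≠ 0 → NearC i c r z.1) :
    (QpsY i (parSymY i) U ∘ₗ QpY i (parSymY i) U) * cutMulY (𝔸 := 𝔸) χ =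
      (QpsCubeY i c (parSymY i) (gaugeY i g⁻¹ (locCfgY i c η A)) ∘ₗ QpCubeY i c (parSymY i) (gaugeY i g⁻¹ (locCfgY i c η A))) * cutMulY (𝔸 := 𝔸) χ := by
  rw [proj_eq_conj i g U, projCube_gauge_inv_eq i c g]
  set Γ : Module.End ℂ (SiteY i → 𝔸) := conjY (gSiteY i g)
  set Γi : Module.End ℂ (SiteY i → 𝔸) := conjY (gSiteY i g)⁻¹
  set C : Module.End ℂ (SiteY i → 𝔸) := cutMulY (𝔸 := 𝔸) χ
  have e : C * Γ = Γ * C := cutMulY_mul_conjY i _ _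
  have law := proj_mul_cutMulY_eq_gauge i c g U η A hQ hgA χ hr hχ
  calc Γi * (QpsY i (parSymY i) (gaugeY i g U) ∘ₗ QpY i (parSymY i) (gaugeY i g U)) * Γ * C
        = Γi * ((QpsY i (parSymY i) (gaugeY i g U) ∘ₗ QpY i (parSymY i) (gaugeY i g U)) * C) * Γ := by rw [mul_assoc (Γi * _) Γ C, ← e]; noncomm_ring
    _ = Γi * ((QpsCubeY i c (parSymY i) (locCfgY i c η A) ∘ₗ QpCubeY i c (parSymY i) (locCfgY i c η A)) * C) * Γ := by rw [law]
    _ = _ := by rw [mul_assoc Γi, mul_assoc _ C Γ, e]; noncomm_ring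

end Agreement

/-! ## §2  The split of the middle (any ring): two `1 − M` words and one commutator word -/

section Ring

variable {𝓡 : Type} [Ring 𝓡]

/-- ★ **THE CORE SPLIT**: with `S·P = S`, `P_□·S_□ = S_□` and a cut-off `M` on which the two projections agree (`M·P = M·P_□`, `P·M = P_□·M`),
`S·(P_□K_□P_□ − PKP)·S_□ = S·P_□·(1 − M)·K_□·S_□ − S·K·(1 − M)·P·S_□ + S·(M·K_□ − K·M)·S_□` — two words carrying the far factor `1 − M` between the projections and the
squared propagators, and one commutator word. [cite: Balaban1985BackgroundPropagators, (3.95) p.411, p.412 l.1–9, p.412 l.22–36, p.415 l.29–37; algebra ours] -/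
theorem core_split (S Sb K Kb P Pb M : 𝓡) (hSP : S * P = S) (hPbSb : Pb * Sb = Sb) (hMP : M * P = M * Pb) (hPM : P * M = Pb * M) :
    S * (Pb * Kb * Pb - P * K * P) * Sb = S * Pb * (1 - M) * Kb * Sb - S * K * (1 - M) * P * Sb + S * (M * Kb - K * M) * Sb := by
  have hSM : S * Pb * M = S * M := by rw [mul_assoc, ← hPM, ← mul_assoc, hSP]
  have hMSb : M * P * Sb = M * Sb := by rw [hMP, mul_assoc, hPbSb]
  have e1 : S * (Pb * Kb * Pb) * Sb = S * Pb * (1 - M) * Kb * Sb + S * M * Kb * Sb := by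
    calc S * (Pb * Kb * Pb) * Sb = S * Pb * Kb * (Pb * Sb) := by noncomm_ring
      _ = S * Pb * Kb * Sb := by rw [hPbSb]
      _ = S * Pb * (1 - M) * Kb * Sb + S * Pb * M * Kb * Sb := by noncomm_ring
      _ = S * Pb * (1 - M) * Kb * Sb + S * M * Kb * Sb := by rw [hSM]
  have e2 : S * (P * K * P) * Sb = S * K * (1 - M) * P * Sb + S * K * M * Sb := by
    calc S * (P * K * P) * Sb = S * P * K * (P * Sb) := by noncomm_ring
      _ = S * K * (P * Sb) := by rw [hSP]
      _ = S * K * (1 - M) * P * Sb + S * K * (M * P * Sb) := by noncomm_ring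
      _ = S * K * (1 - M) * P * Sb + S * K * (M * Sb) := by rw [hMSb]
      _ = S * K * (1 - M) * P * Sb + S * K * M * Sb := by noncomm_ring
  rw [mul_sub, sub_mul, e1, e2]
  noncomm_ring

/-- ★ **THE COMMUTATOR WORD IS MINUS TWO COMMUTATOR-STEP WORDS**: with `A·Δ₁ = 1`, `Δ₂·B = 1` and `Δ₁·M = Δ₂·M` (the two operators agree on the cut-off),
`M·(B·B) − (A·A)·M = −(A·A·R + A·R·B)`, `R = (M·Δ₂ − Δ₂·M)·B` — p21's one-lattice form `B9ThmDLocDiffAlgebra.mul_self_sub_mul_self_eq_comm_form` read for the commutator.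
[cite: Balaban1985BackgroundPropagators, p.412 l.1–9, (3.97) p.412; algebra ours] -/
theorem cut_sq_sub_sq_cut_eq_neg_commStep (A B Δ₁ Δ₂ M : 𝓡) (h1 : A * Δ₁ = 1) (h2 : Δ₂ * B = 1) (hM : Δ₁ * M = Δ₂ * M) :
    M * (B * B) - A * A * M = -(A * A * ((M * Δ₂ - Δ₂ * M) * B) + A * ((M * Δ₂ - Δ₂ * M) * B) * B) := by
  have h := mul_self_sub_mul_self_eq_comm_form h1 h2 hM
  have e : M * (B * B) - A * A * M = -(A * A - B * B - (A * A * (1 - M) - (1 - M) * (B * B))) := by noncomm_ring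
  rw [e, h]
  noncomm_ring

/-- ★ **THE FOUR-WORD FORM OF THE LOCATED CORE** (the two lemmas above, between the outer cut-offs `M, M′`): under the six laws,
`M·S·(P_□(BB)P_□ − P(AA)P)·S_□·M′ = MSP_□(1 − M_c)(BB)S_□M′ − MS(AA)(1 − M_c)PS_□M′ − MS(AA)RS_□M′ − MSARBS_□M′`, `R = (M_cΔ₂ − Δ₂M_c)·B`.
[cite: Balaban1985BackgroundPropagators, (3.95) p.411, p.412 l.1–9, p.415 l.29–37; algebra ours] -/
theorem cut_core_fourWords (M M' S Sb P Pb Mc A B Δ₁ Δ₂ : 𝓡) (hSP : S * P = S) (hPbSb : Pb * Sb = Sb) (hMP : Mc * P = Mc * Pb) (hPM : P * Mc = Pb * Mc)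
    (h1 : A * Δ₁ = 1) (h2 : Δ₂ * B = 1) (hM : Δ₁ * Mc = Δ₂ * Mc) :
    M * S * (Pb * (B * B) * Pb - P * (A * A) * P) * Sb * M' =
      M * S * Pb * (1 - Mc) * (B * B) * Sb * M' - M * S * (A * A) * (1 - Mc) * P * Sb * M' -
        M * S * (A * A) * ((Mc * Δ₂ - Δ₂ * Mc) * B) * Sb * M' - M * S * A * ((Mc * Δ₂ - Δ₂ * Mc) * B) * B * Sb * M' := by
  have hcore := core_split S Sb (A * A) (B * B) P Pb Mc hSP hPbSb hMP hPM
  have hcomm := cut_sq_sub_sq_cut_eq_neg_commStep A B Δ₁ Δ₂ Mc h1 h2 hM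
  have e : M * S * (Pb * (B * B) * Pb - P * (A * A) * P) * Sb * M' = M * (S * (Pb * (B * B) * Pb - P * (A * A) * P) * Sb) * M' := by
    noncomm_ring
  rw [e, hcore, hcomm]
  generalize (Mc * Δ₂ - Δ₂ * Mc) * B = R
  generalize (1 - Mc) = F
  noncomm_ring

end Ring

/-! ## §3  At the letters of the consumer's pair `(U, V′ = Ṽ_□^{u⁻¹})`: the four-word form of `M_χ·(S − S_□)·M_χ′` -/

section Letters

variable (i : KIdx d ℓ hd hL b₀ b₁) (c : ↥(cubes (toKT i).D.toDomains))

set_option maxHeartbeats 1600000 in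
/-- ★★★ **THE LOCATED `C`-DIFFERENCE AT THE CONSUMER's PAIR, AS FOUR ONE-SEPARATION WORDS**: with `S = Q′*X⁻¹Q′(U)` (member letter `G′ = GpY i parSymY`),
`S_□ = Q′*_□X_□⁻¹Q′_□(V′)`, `V′ = Ṽ_□^{u⁻¹}`, `P = Q′*Q′(U)`, `P_□ = Q′*_□Q′_□(V′)`, `R_χ = (M_{χ_□}Δ′_□(V′) − Δ′_□(V′)M_{χ_□})·G′_□(V′)` and outer cut-offs `χ, χ′` supported within `7S_j∕2`:
`M_χ(S − S_□)M_χ′ = M_χSP_□(1 − M_{χ_□})G′_□(V′)²S_□M_χ′ − M_χSG′(U)²(1 − M_{χ_□})PS_□M_χ′ − M_χSG′(U)²R_χS_□M_χ′ − M_χSG′(U)R_χG′_□(V′)S_□M_χ′` — EVERY LAW DISCHARGED from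
the (3.35) datum (§1; p38's FILE 1: `Q′Q′* = 1` ×2, (II); F3-E1: `Δ′(U)M_{χ_□} = Δ′_□(V′)M_{χ_□}`) but the four units `X(U)`, `X_□(V′)` ((3.25)) and `Δ′(U)`, `Δ′_□(V′)` ((3.11)),
displayed as everywhere in the tree. [cite: Balaban1985BackgroundPropagators, p.415 l.29–37, p.412 l.1–9, p.412 l.22–36, (3.95) p.411, (3.97) p.412, (3.25) p.394,
(3.11) p.392, Cor. 3.6 p.408, p.414 l.29–32; Balaban1983RegularityDecay, (1.11)–(1.12) (statement type; algebra ours)] -/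
theorem cut_locCDiff_cut_eq_fourWords (g : GaugeY 𝔸 i) (U : CfgY 𝔸 i) {Q : Set (Site (PV d ℓ i.m i.K hd hL) 0)} (η : ℝ) (A : AfldY 𝔸 i)
    (hQ : ∀ x : Site (PV d ℓ i.m i.K hd hL) 0, NearC i c (35 * SC i c / 8 + 1) (boxEquiv i.hN x).1 → x ∈ Q)
    (hgA : ∀ (κ : Fin (d + 1)) (x : Site (PV d ℓ i.m i.K hd hL) 0), x ∈ Q → x.shift κ ∈ Q → gaugeY i g U κ x = fluct η A κ x)
    (hX : IsUnit (XY i (parSymY i) (fun W => GpY i (parSymY i) W) U)) (hXc : IsUnit (XCubeY i c (parSymY i) (gaugeY i g⁻¹ (locCfgY i c η A))))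
    (hU : IsUnit (deltaPrimeAY i (parSymY i) U)) (hV : IsUnit (deltaPrimeACubeY i c (parSymY i) (gaugeY i g⁻¹ (locCfgY i c η A))))
    (χ χ' : SiteY i → ℝ) {r : ℤ} (hr : r ≤ 7 * SC i c / 2) (hχ : ∀ z, χ z ≠ 0 → NearC i c r z.1) (hχ' : ∀ z, χ' z ≠ 0 → NearC i c r z.1) :
    cutMulY (𝔸 := 𝔸) χ *
        ((QpsY i (parSymY i) U ∘ₗ XinvY i (parSymY i) (fun W => GpY i (parSymY i) W) U ∘ₗ QpY i (parSymY i) U) -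
          (QpsCubeY i c (parSymY i) (gaugeY i g⁻¹ (locCfgY i c η A)) ∘ₗ XinvCubeY i c (parSymY i) (gaugeY i g⁻¹ (locCfgY i c η A)) ∘ₗ
            QpCubeY i c (parSymY i) (gaugeY i g⁻¹ (locCfgY i c η A)))) * cutMulY (𝔸 := 𝔸) χ' =
      cutMulY (𝔸 := 𝔸) χ * (QpsY i (parSymY i) U ∘ₗ XinvY i (parSymY i) (fun W => GpY i (parSymY i) W) U ∘ₗ QpY i (parSymY i) U) *
          (QpsCubeY i c (parSymY i) (gaugeY i g⁻¹ (locCfgY i c η A)) ∘ₗ QpCubeY i c (parSymY i) (gaugeY i g⁻¹ (locCfgY i c η A))) *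
          (1 - cutMulY (𝔸 := 𝔸) (chiY i c)) *
          (GpCubeY i c (parSymY i) (gaugeY i g⁻¹ (locCfgY i c η A)) * GpCubeY i c (parSymY i) (gaugeY i g⁻¹ (locCfgY i c η A))) *
          (QpsCubeY i c (parSymY i) (gaugeY i g⁻¹ (locCfgY i c η A)) ∘ₗ XinvCubeY i c (parSymY i) (gaugeY i g⁻¹ (locCfgY i c η A)) ∘ₗ
            QpCubeY i c (parSymY i) (gaugeY i g⁻¹ (locCfgY i c η A))) * cutMulY (𝔸 := 𝔸) χ' -
      cutMulY (𝔸 := 𝔸) χ * (QpsY i (parSymY i) U ∘ₗ XinvY i (parSymY i) (fun W => GpY i (parSymY i) W) U ∘ₗ QpY i (parSymY i) U) *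
          (GpY i (parSymY i) U * GpY i (parSymY i) U) * (1 - cutMulY (𝔸 := 𝔸) (chiY i c)) * (QpsY i (parSymY i) U ∘ₗ QpY i (parSymY i) U) *
          (QpsCubeY i c (parSymY i) (gaugeY i g⁻¹ (locCfgY i c η A)) ∘ₗ XinvCubeY i c (parSymY i) (gaugeY i g⁻¹ (locCfgY i c η A)) ∘ₗ
            QpCubeY i c (parSymY i) (gaugeY i g⁻¹ (locCfgY i c η A))) * cutMulY (𝔸 := 𝔸) χ' -
      cutMulY (𝔸 := 𝔸) χ * (QpsY i (parSymY i) U ∘ₗ XinvY i (parSymY i) (fun W => GpY i (parSymY i) W) U ∘ₗ QpY i (parSymY i) U) *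
          (GpY i (parSymY i) U * GpY i (parSymY i) U) *
          ((cutMulY (𝔸 := 𝔸) (chiY i c) * deltaPrimeACubeY i c (parSymY i) (gaugeY i g⁻¹ (locCfgY i c η A)) -
              deltaPrimeACubeY i c (parSymY i) (gaugeY i g⁻¹ (locCfgY i c η A)) * cutMulY (𝔸 := 𝔸) (chiY i c)) *
            GpCubeY i c (parSymY i) (gaugeY i g⁻¹ (locCfgY i c η A))) *
          (QpsCubeY i c (parSymY i) (gaugeY i g⁻¹ (locCfgY i c η A)) ∘ₗ XinvCubeY i c (parSymY i) (gaugeY i g⁻¹ (locCfgY i c η A)) ∘ₗ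
            QpCubeY i c (parSymY i) (gaugeY i g⁻¹ (locCfgY i c η A))) * cutMulY (𝔸 := 𝔸) χ' -
      cutMulY (𝔸 := 𝔸) χ * (QpsY i (parSymY i) U ∘ₗ XinvY i (parSymY i) (fun W => GpY i (parSymY i) W) U ∘ₗ QpY i (parSymY i) U) *
          GpY i (parSymY i) U *
          ((cutMulY (𝔸 := 𝔸) (chiY i c) * deltaPrimeACubeY i c (parSymY i) (gaugeY i g⁻¹ (locCfgY i c η A)) -
              deltaPrimeACubeY i c (parSymY i) (gaugeY i g⁻¹ (locCfgY i c η A)) * cutMulY (𝔸 := 𝔸) (chiY i c)) *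
            GpCubeY i c (parSymY i) (gaugeY i g⁻¹ (locCfgY i c η A))) *
          GpCubeY i c (parSymY i) (gaugeY i g⁻¹ (locCfgY i c η A)) *
          (QpsCubeY i c (parSymY i) (gaugeY i g⁻¹ (locCfgY i c η A)) ∘ₗ XinvCubeY i c (parSymY i) (gaugeY i g⁻¹ (locCfgY i c η A)) ∘ₗ
            QpCubeY i c (parSymY i) (gaugeY i g⁻¹ (locCfgY i c η A))) * cutMulY (𝔸 := 𝔸) χ' := by
  -- names for the letters
  set V' : CfgY 𝔸 i := gaugeY i g⁻¹ (locCfgY i c η A) with hV'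
  set S : Module.End ℂ (SiteY i → 𝔸) :=
    QpsY i (parSymY i) U ∘ₗ XinvY i (parSymY i) (fun W => GpY i (parSymY i) W) U ∘ₗ QpY i (parSymY i) U with hSdef
  set Sb : Module.End ℂ (SiteY i → 𝔸) := QpsCubeY i c (parSymY i) V' ∘ₗ XinvCubeY i c (parSymY i) V' ∘ₗ QpCubeY i c (parSymY i) V' with hSbdef
  set P : Module.End ℂ (SiteY i → 𝔸) := QpsY i (parSymY i) U ∘ₗ QpY i (parSymY i) U with hPdef
  set Pb : Module.End ℂ (SiteY i → 𝔸) := QpsCubeY i c (parSymY i) V' ∘ₗ QpCubeY i c (parSymY i) V' with hPbdef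
  set M : Module.End ℂ (SiteY i → 𝔸) := cutMulY (𝔸 := 𝔸) χ with hMdef
  set M' : Module.End ℂ (SiteY i → 𝔸) := cutMulY (𝔸 := 𝔸) χ' with hM'def
  set Mφ : Module.End ℂ (SiteY i → 𝔸) := cutMulY (𝔸 := 𝔸) (chiY i c) with hMφdef
  set O : Module.End ℂ (SiteY i → 𝔸) := GpY i (parSymY i) U with hOdef
  set B : Module.End ℂ (SiteY i → 𝔸) := GpCubeY i c (parSymY i) V' with hBdef
  set Δ₁ : Module.End ℂ (SiteY i → 𝔸) := deltaPrimeAY i (parSymY i) U with hΔ₁def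
  set Δ₂ : Module.End ℂ (SiteY i → 𝔸) := deltaPrimeACubeY i c (parSymY i) V' with hΔ₂def
  -- the two `X`-letters of (3.21), as products `P·G′²·P`, `P_□·G′_□²·P_□`
  have hA : QpsY i (parSymY i) U ∘ₗ XY i (parSymY i) (fun W => GpY i (parSymY i) W) U ∘ₗ QpY i (parSymY i) U = P * (O * O) * P := by
    refine LinearMap.ext fun Λ => ?_
    simp only [hPdef, hOdef, XY, Module.End.mul_apply, LinearMap.comp_apply]
  have hAb : QpsCubeY i c (parSymY i) V' ∘ₗ XCubeY i c (parSymY i) V' ∘ₗ QpCubeY i c (parSymY i) V' = Pb * (B * B) * Pb := by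
    refine LinearMap.ext fun Λ => ?_
    simp only [hPbdef, hBdef, XCubeY, Module.End.mul_apply, LinearMap.comp_apply]
  -- the laws
  have hQQ := QpY_comp_QpsY i (parSymY i) U
  have hQQc := QpCubeY_comp_QpsCubeY i (parSymY i) V' c
  have hSA : S * (QpsY i (parSymY i) U ∘ₗ XY i (parSymY i) (fun W => GpY i (parSymY i) W) U ∘ₗ QpY i (parSymY i) U) = P :=
    S_mul_A_eq_P i (parSymY i) (fun W => GpY i (parSymY i) W) U hQQ hX
  have hSP : S * P = S := S_mul_P_eq_S i (parSymY i) (fun W => GpY i (parSymY i) W) U hQQ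
  have hAbSb : (QpsCubeY i c (parSymY i) V' ∘ₗ XCubeY i c (parSymY i) V' ∘ₗ QpCubeY i c (parSymY i) V') * Sb = Pb :=
    Ab_mul_Sb_eq_Pb i c (parSymY i) V' hQQc hXc
  have hPbSb : Pb * Sb = Sb := Pb_mul_Sb_eq_Sb i c (parSymY i) V' hQQc
  have hMP : M * P = M * Pb := cutMulY_mul_proj_eq_at i c g U η A hQ hgA χ hr hχ
  have hPM' : P * M' = Pb * M' := proj_mul_cutMulY_eq_at i c g U η A hQ hgA χ' hr hχ'
  have hMφP : Mφ * P = Mφ * Pb := cutMulY_mul_proj_eq_at i c g U η A hQ hgA (chiY i c) le_rfl fun z hz => nearC_of_chiY_ne_zero i c hz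
  have hPMφ : P * Mφ = Pb * Mφ := proj_mul_cutMulY_eq_at i c g U η A hQ hgA (chiY i c) le_rfl fun z hz => nearC_of_chiY_ne_zero i c hz
  have h1 : O * Δ₁ = 1 := GpY_mul_deltaPrimeAY i (parSymY i) U hU
  have h2 : Δ₂ * B = 1 := deltaPrimeACubeY_mul_GpCubeY i c (parSymY i) V' hV
  have hΔM : Δ₁ * Mφ = Δ₂ * Mφ := deltaPrimeAY_mul_cutMulY_chiY_at i c g U η A hQ hgA
  -- (II), then §2's four-word form of the core
  have hII := cut_sub_cut_eq_resolvent_form S Sb _ _ P Pb M M' hSA hAbSb hSP hPbSb hMP hPM'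
  rw [hII, hAb, hA]
  exact cut_core_fourWords M M' S Sb P Pb Mφ O B Δ₁ Δ₂ hSP hPbSb hMφP hPMφ h1 h2 hΔM

end Letters

end Literature.MathematicalPhysics.QuantumFieldTheory.Balaban1983to89.B9Eq3105FamThreeLocCDiffSplit
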